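import Summits.QuantumFields.YangMills.Theorems.FluctuationComparisonRegPrIntLOrganTangentJTSqOfHdispNear
import HarnessLib

/-!
# Crux `FluctuationComparisonRegPrIntL` (stmt-QuantumFields-20520, rung R3), PATH-B organ — «THE (JT-h)sq DOOR WITH A CRUDE GOOD-SET LETTER» (amendment A5 of the (I-curv) group,
# UV3-NODE §80.4 (c); LEAD `ym-ust-20520-w3` g27 №16 (A) «A5 PRICED S»; DEFINITION-FREE): ✓p820521's two doors with the differential curvature square clause (γ-near) and its
# plaquette letters `kP gP KP KP2` REPLACED by ONE hypothesis — the CRUDE good-set pair letter `kG` at the observable square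

Cell `ym3-torus` (YM ladder rung R3 = continuum `SU(2)` Yang–Mills on the three-torus — a RUNG: NOT d = 4, NOT infinite volume, NOT a mass gap, NOT Clay).
Width seat `ym3-torus-px19` (gen 22, the §72∕§73∕§74∕§80 lineage; door pen for row-sq v0.4 named by LEAD №16 (A) ∕ ★★OWNER RULING №91 (2));
`--kind proof --supports stmt-QuantumFields-20520 --as helper`, count-neutral, no registry ∕ binder ∕ `Lines/` edit, default heartbeats, `autoImplicit false`.

WHAT.  ★★`jtBracket_of_cornerStability_crude` (= LEAD w3 g27's scratch `SCRATCH-JTSqOfHdispCrude.w3g27.lean` ba2049fe, binder-for-binder — the two pens converged independently) = ✓p820521 `jtBracket_of_cornerStability_near` with the block (γ-near) {`ιP`, `kP gP KP KP2`, their signs, `hcurv` (the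
`∃ (F₂ F₁₂) (α α′ γ′)` differential clause with the A1 corner antecedent)} REPLACED by «(γ-crude)»: `{kG : ℝ} (hkG : 0 ≤ kG) (Good) (hGood)` and
`hG : ∀ z ∈ Good, ŵ_t(Xw, z) ≠ 0 → |ΔΔ(log ρ_Ts∕ρ′_Ts ∘ Φ)(U V W Y; z)| ≤ kG·(‖m‖∕θc)·(‖m′‖∕θc)` — the `HClauseSq`-shaped DOUBLE-DIFFERENCE bound at the observable
square, which is what print's road delivers (two-step Cauchy on the coarse bidisc, ✓`…OrganTangentBidiscDoubleDifference.norm_doubleDiff_le_min`); the corner disjunction `hXwc`, the bond∕relational∕admissibility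
binders of the square and `rc` are no longer needed by the door itself (they served only (γ-near)'s antecedents) and live in the wrapper only; conclusion = the (JT-h) bracket text with letter `kG + ES·kB`
(CHARACTER-EXACT shape of ✓p820521's, `Σ KP·kP·KP + Σ gP·KP2 ↦ kG`).  Proof = ✓p820521's (α)(β′)(δ)(ε) verbatim with the (γ) step deleted (one `obtain` and one
`exact hClauseSq_of_curvData …` fewer).  ★★★`jtBracket_sq_of_hdisp_crude` = the `…_sq_of_hdisp` wrapper (px20 ✓`hstab_corners_of_hdisp` ∘ ★★), the knit-v0.4 (JT-h)sq
line as ONE name: `exact jtBracket_sq_of_hdisp_crude … hXwc hkG Good hGood hG hkB hES (hcrude …) htail`.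

WHY (UV3-NODE §80, LOCATE (b) «CAUCHY ROAD»; ★★OWNER RULING №91; LEAD №16): v0.3 ⟹ A5 with `kG := Σ KP·kP·KP + Σ gP·KP2`, `hG := hClauseSq_of_curvData ∘ hcurv` (✓p820521's
own (γ) step), so every v0.3 discharger is an A5 discharger and this door is a PURE WEAKENING of ✓p820521's hypotheses; on the Cauchy road the discharger lands directly in
`hG`'s shape.  D-5 (the `∀ (k, w)`-linear mass tie vs intrinsic tube letters) is untouched by this file — it lives in the ROW's tie, not in the door.

HONEST FRAMING: measure∕`Finset` bookkeeping over HYPOTHESIS texts; nothing of Bałaban's analysis is asserted or proved; `hG`, `hcrude`, the corner-stability texts are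
HYPOTHESES; the (I-curv) row (every edition), `SpreadFibreLawH(J)(sq)`, `OrganDischargeInputsHJ(sq)` v0.1–v0.4, O1ᵘ-H v2.2, S1aᴴ, S3ᴴ, S2α′, S2β, 26243, the five registered
stubs, crux 20520 `FluctuationComparisonRegPrIntL` and `YM3TorusSU2` are NOT proved; no summit ∕ sub-problem statement is proved; registry `Lines/semiclassical_s2beta.lean`
3732b7df untouched; rung R3 = SU(2) YM₃ on T³ at fixed lattice data — NOT d = 4, NOT infinite volume, NOT a mass gap, NOT Clay; the Yang–Mills mass gap is NOT proved.  [folklore]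
-/

set_option autoImplicit false

noncomputable section

namespace Summit.QuantumFields.YangMills.Theorems.OrganTangentJTSqOfHdispCrude

open MeasureTheory Filter Topology Function Set
open scoped ENNReal NNReal BigOperators
open Literature.MathematicalPhysics.QuantumFieldTheory.Balaban1983to89 T3ContinuumYM3Torus T3NestedUnitLaws
  T3UnitLawDensityEML T4Continuum BalabanUVClass T3UnitScaleTilt T3LevelShift T3TiltDescent
open T4CubeChartExp (expPt)
open Summit.QuantumFields.YangMills.Theorems.FluctuationComparisonRegPrIntLRunpairOrganFibreLaw (mwCut wNum wgt)
open Summit.QuantumFields.YangMills.Theorems.OrganTangentFibreWeightNormalisation (wgt_normalised)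
open Summit.QuantumFields.YangMills.Theorems.OrganTangentFibreWeightSquareIntegrability (integrable_logRatio_mul_wgt_of_squareStability)
open Summit.QuantumFields.YangMills.Theorems.OrganTangentSecondDiffIntegration (abs_integral_secondDiff_mul_le_good_add_tail secondDiff_letter_bound)
open Summit.QuantumFields.YangMills.Theorems.OrganTangentJTOfCurvatureTransport (wgt_interp_nonneg)
open Summit.QuantumFields.YangMills.Theorems.OrganTangentNearStability (hstab_corners_of_hdisp)

/-- ★★ **JT-E2E FROM CORNER STABILITY WITH A CRUDE GOOD-SET LETTER** (amendment A5's door = ✓p820521 `jtBracket_of_cornerStability_near` with (γ-near) ↦ (γ-crude)):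
THE (JT-h) CONJUNCT TEXT of the row at ONE admissible square `(U V W Y; B m; B′ m′)` and law point `Xw`, for ONE real `t`, FROM: the frame∕chart facts (α); the four
pair-local corner-stability texts (β′); the CRUDE good-set pair letter `hG` (γ-crude); crude letter on `{ŵ ≠ 0}` + tail (δ).  Letter `kG + ES·kB`. [folklore] -/
theorem jtBracket_of_cornerStability_crude (F : T3Family) (γ b₀ p₀ : ℝ) (j Ts : ℕ) (hjTs : j + 1 ≤ Ts)
    (ρ ρ' : (i : ℕ) → GaugeField (F.P i) 0 ↥(Matrix.specialUnitaryGroup (Fin 2) ℂ) → ℝ)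
    (hρm : Measurable (ρ Ts)) (hρ'm : Measurable (ρ' Ts))
    (hρc : ContinuousOn (ρ Ts) {U | PlaqSmall (θBal F.L γ b₀ p₀ Ts) U}) (hρ'c : ContinuousOn (ρ' Ts) {U | PlaqSmall (θBal F.L γ b₀ p₀ Ts) U})
    (hρpos : ∀ U, PlaqSmall (θBal F.L γ b₀ p₀ Ts) U → 0 < ρ Ts U ∧ 0 < ρ' Ts U)
    (hθ : 0 < θBal F.L γ b₀ p₀ Ts) (hθj : 0 < θBal F.L γ b₀ p₀ j)
    (hχc : Continuous (mwCut F γ b₀ p₀ j Ts)) (hχ0 : ∀ U, 0 ≤ mwCut F γ b₀ p₀ j Ts U)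
    (hχsupp : ∀ U, mwCut F γ b₀ p₀ j Ts U ≠ 0 → ∀ (n : ℕ) (hjn : j + 1 ≤ n) (hnK : n ≤ Ts), PlaqSmall (24 / 25 * θBal F.L γ b₀ p₀ n) (descendTo F ℰp n Ts hnK U))
    (hχpos : ∀ U, (∀ (n : ℕ) (hjn : j + 1 ≤ n) (hnK : n ≤ Ts), PlaqSmall (24 / 25 * θBal F.L γ b₀ p₀ n) (descendTo F ℰp n Ts hnK U)) → 0 < mwCut F γ b₀ p₀ j Ts U)
    {Z : Type} [MeasurableSpace Z] (τ : Measure Z) [IsProbabilityMeasure τ]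
    (Φ : GaugeField (F.P j) 0 ↥(Matrix.specialUnitaryGroup (Fin 2) ℂ) × Z → GaugeField (F.P Ts) 0 ↥(Matrix.specialUnitaryGroup (Fin 2) ℂ))
    (J : GaugeField (F.P j) 0 ↥(Matrix.specialUnitaryGroup (Fin 2) ℂ) × Z → ℝ≥0)
    (hΦm : Measurable Φ) (hJm : Measurable J) (CJ : ℝ) (hJle : ∀ V z, (J (V, z) : ℝ) ≤ CJ)
    (hpos : ∀ V, PlaqSmall (θBal F.L γ b₀ p₀ j) V →
      0 < ∫⁻ z in {z | (∀ (n : ℕ) (hjn : j + 1 ≤ n) (hnK : n ≤ Ts), PlaqSmall (24 / 25 * θBal F.L γ b₀ p₀ n) (descendTo F ℰp n Ts hnK (Φ (V, z))))},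
        (J (V, z) : ℝ≥0∞) ∂τ)
    (t : ℝ)
    -- (β′) CORNER STABILITY: the four PAIR-LOCAL square-stability texts at the corners w.r.t. the law point `Xw` — HYPOTHESES here
    {c : ℝ} (hc : c < 1)
    -- the four corner configurations, the two move sizes, and the law point (the door needs NO relational ∕ admissibility structure: that lives in the wrapper)
    (m m' : Fin 3 → ℝ) (U V W Y Xw : GaugeField (F.P j) 0 ↥(Matrix.specialUnitaryGroup (Fin 2) ℂ))
    (hXw : PlaqSmall (θBal F.L γ b₀ p₀ j / 4) Xw)
    (hstabU : ∀ z, mwCut F γ b₀ p₀ j Ts (Φ (Xw, z)) ≠ 0 → ∀ p, dist1 (GaugeField.plaqHol (Φ (U, z)) p) ≤ c * θBal F.L γ b₀ p₀ Ts)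
    (hstabV : ∀ z, mwCut F γ b₀ p₀ j Ts (Φ (Xw, z)) ≠ 0 → ∀ p, dist1 (GaugeField.plaqHol (Φ (V, z)) p) ≤ c * θBal F.L γ b₀ p₀ Ts)
    (hstabW : ∀ z, mwCut F γ b₀ p₀ j Ts (Φ (Xw, z)) ≠ 0 → ∀ p, dist1 (GaugeField.plaqHol (Φ (W, z)) p) ≤ c * θBal F.L γ b₀ p₀ Ts)
    (hstabY : ∀ z, mwCut F γ b₀ p₀ j Ts (Φ (Xw, z)) ≠ 0 → ∀ p, dist1 (GaugeField.plaqHol (Φ (Y, z)) p) ≤ c * θBal F.L γ b₀ p₀ Ts)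
    -- (γ-crude) AMENDMENT A5 (UV3-NODE §80.4 (c); LEAD w3 g27 №16 (A)): the CRUDE good-set pair letter `kG` of `h_Ts ∘ Φ(·, z)` AT THE OBSERVABLE SQUARE — a HYPOTHESIS
    (Good : Set Z) (hGood : MeasurableSet Good)
    {kG : ℝ} (hkG : 0 ≤ kG)
    (hG : ∀ z ∈ Good, wgt F γ b₀ p₀ j Ts ρ ρ' τ Φ J t Xw z ≠ 0 →
      |(Real.log (ρ Ts (Φ (Y, z))) - Real.log (ρ' Ts (Φ (Y, z)))) - (Real.log (ρ Ts (Φ (V, z))) - Real.log (ρ' Ts (Φ (V, z))))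
        - (Real.log (ρ Ts (Φ (W, z))) - Real.log (ρ' Ts (Φ (W, z)))) + (Real.log (ρ Ts (Φ (U, z))) - Real.log (ρ' Ts (Φ (U, z))))|
        ≤ kG * (‖m‖ / (θBal F.L γ b₀ p₀ j / 4)) * (‖m'‖ / (θBal F.L γ b₀ p₀ j / 4)))
    -- (δ) crude letter on the law's support and tail of the good set
    {kB ES : ℝ} (hkB : 0 ≤ kB) (hES : 0 ≤ ES)
    (hcrude : ∀ z, wgt F γ b₀ p₀ j Ts ρ ρ' τ Φ J t Xw z ≠ 0 →
      |(Real.log (ρ Ts (Φ (Y, z))) - Real.log (ρ' Ts (Φ (Y, z)))) - (Real.log (ρ Ts (Φ (V, z))) - Real.log (ρ' Ts (Φ (V, z))))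
        - (Real.log (ρ Ts (Φ (W, z))) - Real.log (ρ' Ts (Φ (W, z)))) + (Real.log (ρ Ts (Φ (U, z))) - Real.log (ρ' Ts (Φ (U, z))))|
        ≤ kB * (‖m‖ / (θBal F.L γ b₀ p₀ j / 4)) * (‖m'‖ / (θBal F.L γ b₀ p₀ j / 4)))
    (htail : ∫ z in Goodᶜ, wgt F γ b₀ p₀ j Ts ρ ρ' τ Φ J t Xw z ∂τ ≤ ES) :
    Integrable (fun z => (Real.log (ρ Ts (Φ (U, z))) - Real.log (ρ' Ts (Φ (U, z)))) * (wgt F γ b₀ p₀ j Ts ρ ρ' τ Φ J t) Xw z) τ ∧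
    Integrable (fun z => (Real.log (ρ Ts (Φ (V, z))) - Real.log (ρ' Ts (Φ (V, z)))) * (wgt F γ b₀ p₀ j Ts ρ ρ' τ Φ J t) Xw z) τ ∧
    Integrable (fun z => (Real.log (ρ Ts (Φ (W, z))) - Real.log (ρ' Ts (Φ (W, z)))) * (wgt F γ b₀ p₀ j Ts ρ ρ' τ Φ J t) Xw z) τ ∧
    Integrable (fun z => (Real.log (ρ Ts (Φ (Y, z))) - Real.log (ρ' Ts (Φ (Y, z)))) * (wgt F γ b₀ p₀ j Ts ρ ρ' τ Φ J t) Xw z) τ ∧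
    |∫ z, ((Real.log (ρ Ts (Φ (Y, z))) - Real.log (ρ' Ts (Φ (Y, z)))) - (Real.log (ρ Ts (Φ (V, z))) - Real.log (ρ' Ts (Φ (V, z))))
      - (Real.log (ρ Ts (Φ (W, z))) - Real.log (ρ' Ts (Φ (W, z)))) + (Real.log (ρ Ts (Φ (U, z))) - Real.log (ρ' Ts (Φ (U, z)))))
        * (wgt F γ b₀ p₀ j Ts ρ ρ' τ Φ J t) Xw z ∂τ|
      ≤ (kG + ES * kB)
        * (‖m‖ / (θBal F.L γ b₀ p₀ j / 4)) * (‖m'‖ / (θBal F.L γ b₀ p₀ j / 4)) := by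
  classical
  -- abbreviations
  set θc : ℝ := θBal F.L γ b₀ p₀ j / 4 with hθc
  set ŵ : Z → ℝ := fun z => wgt F γ b₀ p₀ j Ts ρ ρ' τ Φ J t Xw z with hŵ
  have hθc0 : 0 < θc := by rw [hθc]; positivity
  have hθc_le : θc ≤ θBal F.L γ b₀ p₀ j := by rw [hθc]; linarith
  have hXwj : PlaqSmall (θBal F.L γ b₀ p₀ j) Xw := fun p => lt_of_lt_of_le (hXw p) hθc_le
  -- (α) the law is a probability law with a non-negative density
  obtain ⟨_, hmass, hwi, hwn⟩ := wgt_normalised F γ b₀ p₀ j Ts hjTs ρ ρ' hρm hρ'm hρc hρ'c hρpos hθ hχc hχ0 hχsupp hχpos τ Φ J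
    hΦm hJm CJ hJle hpos t Xw hXwj
  have hwnn : ∀ z, 0 ≤ ŵ z := fun z => wgt_interp_nonneg F γ b₀ p₀ j Ts ρ ρ' hρpos hθ hχ0 hχsupp hjTs τ Φ J t Xw hmass z
  -- the four integrabilities (✓p815882) from the four corner-stability texts
  have hint : ∀ (X : GaugeField (F.P j) 0 ↥(Matrix.specialUnitaryGroup (Fin 2) ℂ)),
      (∀ z, mwCut F γ b₀ p₀ j Ts (Φ (Xw, z)) ≠ 0 → ∀ p, dist1 (GaugeField.plaqHol (Φ (X, z)) p) ≤ c * θBal F.L γ b₀ p₀ Ts) →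
      Integrable (fun z => (Real.log (ρ Ts (Φ (X, z))) - Real.log (ρ' Ts (Φ (X, z)))) * wgt F γ b₀ p₀ j Ts ρ ρ' τ Φ J t Xw z) τ :=
    fun X hX => (integrable_logRatio_mul_wgt_of_squareStability F γ b₀ p₀ j Ts hjTs ρ ρ' hρm hρ'm hρc hρ'c hρpos hθ hχc hχ0 hχsupp hχpos τ Φ J
      hΦm hJm CJ hJle hpos c hc t X Xw hXwj hX).1
  refine ⟨hint U hstabU, hint V hstabV, hint W hstabW, hint Y hstabY, ?_⟩
  have hsz : 0 ≤ ‖m‖ / θc := div_nonneg (norm_nonneg _) hθc0.le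
  have hsz' : 0 ≤ ‖m'‖ / θc := div_nonneg (norm_nonneg _) hθc0.le
  -- (ε) integrate: JT-INT with the good-set letter `kG` (hypothesis (γ-crude)) and the crude letter `kB` on the tail
  have hI := abs_integral_secondDiff_mul_le_good_add_tail τ
    (fun z => Real.log (ρ Ts (Φ (U, z))) - Real.log (ρ' Ts (Φ (U, z))))
    (fun z => Real.log (ρ Ts (Φ (V, z))) - Real.log (ρ' Ts (Φ (V, z))))
    (fun z => Real.log (ρ Ts (Φ (W, z))) - Real.log (ρ' Ts (Φ (W, z))))
    (fun z => Real.log (ρ Ts (Φ (Y, z))) - Real.log (ρ' Ts (Φ (Y, z))))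
    ŵ Good hGood hwi hwnn hwn ES htail (kG * (‖m‖ / θc) * (‖m'‖ / θc)) (kB * (‖m‖ / θc) * (‖m'‖ / θc))
    (mul_nonneg (mul_nonneg hkG hsz) hsz') (mul_nonneg (mul_nonneg hkB hsz) hsz') (fun z hzG hzw => hG z hzG hzw) (fun z hz => hcrude z hz)
  have hfin := (secondDiff_letter_bound (I := ∫ z, ((Real.log (ρ Ts (Φ (Y, z))) - Real.log (ρ' Ts (Φ (Y, z))))
      - (Real.log (ρ Ts (Φ (V, z))) - Real.log (ρ' Ts (Φ (V, z)))) - (Real.log (ρ Ts (Φ (W, z))) - Real.log (ρ' Ts (Φ (W, z))))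
      + (Real.log (ρ Ts (Φ (U, z))) - Real.log (ρ' Ts (Φ (U, z))))) * ŵ z ∂τ)
    hkG hkB hES (by
      have e : kG * (‖m‖ / θc) * (‖m'‖ / θc) + kB * (‖m‖ / θc) * (‖m'‖ / θc) * ES
          = kG * (‖m‖ / θc) * (‖m'‖ / θc) + (kB * (‖m‖ / θc) * (‖m'‖ / θc)) * ES := by ring
      rw [e]; exact hI)).2
  exact hfin


/-- ★★★ **(JT-h)sq FROM THE ROW's ONE-BOND LETTER WITH A CRUDE GOOD-SET LETTER** (amendment A5's knit line = ✓p820521 `jtBracket_sq_of_hdisp_near` with (γ-near) ↦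
(γ-crude)): from the frame facts (α), the row's `hdisp` text + uniform cap `Db` + near room `24∕25·θBal_Ts + 3·(Db·rc) ≤ c·θBal_Ts` + the corner disjunction `hXwc`
(px20 ✓`hstab_corners_of_hdisp`), the CRUDE good-set letter `hG`, crude letter + tail (δ). [folklore] -/
theorem jtBracket_sq_of_hdisp_crude (F : T3Family) (γ b₀ p₀ : ℝ) (j Ts : ℕ) (hjTs : j + 1 ≤ Ts)
    (ρ ρ' : (i : ℕ) → GaugeField (F.P i) 0 ↥(Matrix.specialUnitaryGroup (Fin 2) ℂ) → ℝ)
    (hρm : Measurable (ρ Ts)) (hρ'm : Measurable (ρ' Ts))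
    (hρc : ContinuousOn (ρ Ts) {U | PlaqSmall (θBal F.L γ b₀ p₀ Ts) U}) (hρ'c : ContinuousOn (ρ' Ts) {U | PlaqSmall (θBal F.L γ b₀ p₀ Ts) U})
    (hρpos : ∀ U, PlaqSmall (θBal F.L γ b₀ p₀ Ts) U → 0 < ρ Ts U ∧ 0 < ρ' Ts U)
    (hθ : 0 < θBal F.L γ b₀ p₀ Ts) (hθj : 0 < θBal F.L γ b₀ p₀ j)
    (hχc : Continuous (mwCut F γ b₀ p₀ j Ts)) (hχ0 : ∀ U, 0 ≤ mwCut F γ b₀ p₀ j Ts U)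
    (hχsupp : ∀ U, mwCut F γ b₀ p₀ j Ts U ≠ 0 → ∀ (n : ℕ) (hjn : j + 1 ≤ n) (hnK : n ≤ Ts), PlaqSmall (24 / 25 * θBal F.L γ b₀ p₀ n) (descendTo F ℰp n Ts hnK U))
    (hχpos : ∀ U, (∀ (n : ℕ) (hjn : j + 1 ≤ n) (hnK : n ≤ Ts), PlaqSmall (24 / 25 * θBal F.L γ b₀ p₀ n) (descendTo F ℰp n Ts hnK U)) → 0 < mwCut F γ b₀ p₀ j Ts U)
    {Z : Type} [MeasurableSpace Z] (τ : Measure Z) [IsProbabilityMeasure τ]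
    (Φ : GaugeField (F.P j) 0 ↥(Matrix.specialUnitaryGroup (Fin 2) ℂ) × Z → GaugeField (F.P Ts) 0 ↥(Matrix.specialUnitaryGroup (Fin 2) ℂ))
    (J : GaugeField (F.P j) 0 ↥(Matrix.specialUnitaryGroup (Fin 2) ℂ) × Z → ℝ≥0)
    (hΦm : Measurable Φ) (hJm : Measurable J) (CJ : ℝ) (hJle : ∀ V z, (J (V, z) : ℝ) ≤ CJ)
    (hpos : ∀ V, PlaqSmall (θBal F.L γ b₀ p₀ j) V →
      0 < ∫⁻ z in {z | (∀ (n : ℕ) (hjn : j + 1 ≤ n) (hnK : n ≤ Ts), PlaqSmall (24 / 25 * θBal F.L γ b₀ p₀ n) (descendTo F ℰp n Ts hnK (Φ (V, z))))},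
        (J (V, z) : ℝ≥0∞) ∂τ)
    (t : ℝ)
    {rc c : ℝ} (hc : c < 1)
    -- the square and the law point
    (B B' : PBond (F.P j) 0) (m m' : Fin 3 → ℝ) (U V W Y Xw : GaugeField (F.P j) 0 ↥(Matrix.specialUnitaryGroup (Fin 2) ℂ))
    (hm : ‖m‖ ≤ rc * (θBal F.L γ b₀ p₀ j / 4)) (hm' : ‖m'‖ ≤ rc * (θBal F.L γ b₀ p₀ j / 4))
    (hU : PlaqSmall (θBal F.L γ b₀ p₀ j / 4) U) (hV : PlaqSmall (θBal F.L γ b₀ p₀ j / 4) V) (hW : PlaqSmall (θBal F.L γ b₀ p₀ j / 4) W)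
    (hY : PlaqSmall (θBal F.L γ b₀ p₀ j / 4) Y) (hXw : PlaqSmall (θBal F.L γ b₀ p₀ j / 4) Xw)
    (hVU : ∀ e, e ≠ B → V e = U e) (hVb : V B = U B * expPt m) (hWU : ∀ e, e ≠ B' → W e = U e) (hWb : W B' = U B' * expPt m')
    (hYV : ∀ e, e ≠ B' → Y e = V e) (hYb : Y B' = V B' * expPt m')
    -- (β-sq) the ROW's one-bond displacement text `hdisp`, uniform cap, NEAR room `3·Db·rc`, law point a CORNER
    (Db : ℝ) (hrc0 : 0 ≤ rc) (hDb0 : 0 ≤ Db) (DP : Plaq (F.P Ts) 0 → PBond (F.P j) 0 → ℝ) (hDb : ∀ p b, DP p b ≤ Db)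
    (hdisp : ∀ (z : Z) (X : GaugeField (F.P j) 0 ↥(Matrix.specialUnitaryGroup (Fin 2) ℂ)), PlaqSmall (θBal F.L γ b₀ p₀ j) X →
      ∀ (b : PBond (F.P j) 0) (v : Fin 3 → ℝ), ‖v‖ ≤ rc * (θBal F.L γ b₀ p₀ j / 4) → ∀ s ∈ Icc (0 : ℝ) 1, ∀ p : Plaq (F.P Ts) 0,
        dist1 (GaugeField.plaqHol (Φ (update X b (X b * expPt (s • v)), z)) p)
          ≤ dist1 (GaugeField.plaqHol (Φ (X, z)) p) + DP p b * (‖v‖ / (θBal F.L γ b₀ p₀ j / 4)))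
    (hroom : 24 / 25 * θBal F.L γ b₀ p₀ Ts + 3 * (Db * rc) ≤ c * θBal F.L γ b₀ p₀ Ts)
    (hXwc : Xw = U ∨ Xw = V ∨ Xw = W ∨ Xw = Y)
    -- (γ-crude) AMENDMENT A5 (UV3-NODE §80.4 (c); LEAD w3 g27 №16 (A)): the CRUDE good-set pair letter `kG` of `h_Ts ∘ Φ(·, z)` AT THE OBSERVABLE SQUARE — a HYPOTHESIS
    (Good : Set Z) (hGood : MeasurableSet Good)
    {kG : ℝ} (hkG : 0 ≤ kG)
    (hG : ∀ z ∈ Good, wgt F γ b₀ p₀ j Ts ρ ρ' τ Φ J t Xw z ≠ 0 →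
      |(Real.log (ρ Ts (Φ (Y, z))) - Real.log (ρ' Ts (Φ (Y, z)))) - (Real.log (ρ Ts (Φ (V, z))) - Real.log (ρ' Ts (Φ (V, z))))
        - (Real.log (ρ Ts (Φ (W, z))) - Real.log (ρ' Ts (Φ (W, z)))) + (Real.log (ρ Ts (Φ (U, z))) - Real.log (ρ' Ts (Φ (U, z))))|
        ≤ kG * (‖m‖ / (θBal F.L γ b₀ p₀ j / 4)) * (‖m'‖ / (θBal F.L γ b₀ p₀ j / 4)))
    -- (δ) crude letter on the law's support and tail of the good set
    {kB ES : ℝ} (hkB : 0 ≤ kB) (hES : 0 ≤ ES)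
    (hcrude : ∀ z, wgt F γ b₀ p₀ j Ts ρ ρ' τ Φ J t Xw z ≠ 0 →
      |(Real.log (ρ Ts (Φ (Y, z))) - Real.log (ρ' Ts (Φ (Y, z)))) - (Real.log (ρ Ts (Φ (V, z))) - Real.log (ρ' Ts (Φ (V, z))))
        - (Real.log (ρ Ts (Φ (W, z))) - Real.log (ρ' Ts (Φ (W, z)))) + (Real.log (ρ Ts (Φ (U, z))) - Real.log (ρ' Ts (Φ (U, z))))|
        ≤ kB * (‖m‖ / (θBal F.L γ b₀ p₀ j / 4)) * (‖m'‖ / (θBal F.L γ b₀ p₀ j / 4)))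
    (htail : ∫ z in Goodᶜ, wgt F γ b₀ p₀ j Ts ρ ρ' τ Φ J t Xw z ∂τ ≤ ES) :
    Integrable (fun z => (Real.log (ρ Ts (Φ (U, z))) - Real.log (ρ' Ts (Φ (U, z)))) * (wgt F γ b₀ p₀ j Ts ρ ρ' τ Φ J t) Xw z) τ ∧
    Integrable (fun z => (Real.log (ρ Ts (Φ (V, z))) - Real.log (ρ' Ts (Φ (V, z)))) * (wgt F γ b₀ p₀ j Ts ρ ρ' τ Φ J t) Xw z) τ ∧
    Integrable (fun z => (Real.log (ρ Ts (Φ (W, z))) - Real.log (ρ' Ts (Φ (W, z)))) * (wgt F γ b₀ p₀ j Ts ρ ρ' τ Φ J t) Xw z) τ ∧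
    Integrable (fun z => (Real.log (ρ Ts (Φ (Y, z))) - Real.log (ρ' Ts (Φ (Y, z)))) * (wgt F γ b₀ p₀ j Ts ρ ρ' τ Φ J t) Xw z) τ ∧
    |∫ z, ((Real.log (ρ Ts (Φ (Y, z))) - Real.log (ρ' Ts (Φ (Y, z)))) - (Real.log (ρ Ts (Φ (V, z))) - Real.log (ρ' Ts (Φ (V, z))))
      - (Real.log (ρ Ts (Φ (W, z))) - Real.log (ρ' Ts (Φ (W, z)))) + (Real.log (ρ Ts (Φ (U, z))) - Real.log (ρ' Ts (Φ (U, z)))))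
        * (wgt F γ b₀ p₀ j Ts ρ ρ' τ Φ J t) Xw z ∂τ|
      ≤ (kG + ES * kB)
        * (‖m‖ / (θBal F.L γ b₀ p₀ j / 4)) * (‖m'‖ / (θBal F.L γ b₀ p₀ j / 4)) := by
  have hst := hstab_corners_of_hdisp F γ b₀ p₀ j Ts hjTs hχsupp Φ hθj c Db rc hrc0 hDb0 DP hDb hdisp hroom
  exact jtBracket_of_cornerStability_crude F γ b₀ p₀ j Ts hjTs ρ ρ' hρm hρ'm hρc hρ'c hρpos hθ hθj hχc hχ0 hχsupp hχpos τ Φ J hΦm hJm CJ hJle hpos t hc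
    m m' U V W Y Xw hXw
    (fun z hz p => hst z B B' m m' U V W Y hm hm' hU hV hW hY hVU hVb hWU hWb hYV hYb U Xw (Or.inl rfl) hXwc hz p)
    (fun z hz p => hst z B B' m m' U V W Y hm hm' hU hV hW hY hVU hVb hWU hWb hYV hYb V Xw (Or.inr (Or.inl rfl)) hXwc hz p)
    (fun z hz p => hst z B B' m m' U V W Y hm hm' hU hV hW hY hVU hVb hWU hWb hYV hYb W Xw (Or.inr (Or.inr (Or.inl rfl))) hXwc hz p)
    (fun z hz p => hst z B B' m m' U V W Y hm hm' hU hV hW hY hVU hVb hWU hWb hYV hYb Y Xw (Or.inr (Or.inr (Or.inr rfl))) hXwc hz p)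
    Good hGood hkG hG hkB hES hcrude htail

end Summit.QuantumFields.YangMills.Theorems.OrganTangentJTSqOfHdispCrude

end
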